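import Summits.Schanuel.Schanuel.Theorems.RootDecomp1KHyper03

/-!
# RootDecomp1KHyper — part 4 of the «HyperCarving» port wave (lens 6, gen 9 = ROUND 4 of route-Schanuel-RootDecomp1K; 19 parts planned)

Mechanical port (census-1 gen 7, dependency closure; tools census/tools/gen7/portkit2.py + build_l6g9.py) of §17 of HOME/decomp-schanuel-lens-6/g9/HyperCarving.lean
(sha256 aba5c91f…, 8041 l; critic CLEARED FOR TYPING 2026-08-30T13:33:07Z; writer PATH A″ rev 5–8) together with the §§0–16 declarations it depends on
(nothing of the node was in the tree before except RootDecomp1KLinLiouvilleSplit and the Literature fact NesterenkoWaldschmidt1996_thm_5_1).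
This part: node lines 2409–2952 (17 declarations: exists_int_mvrelation, LWMeasure, mvPolyMeasure_of_heightMeasure, mvPolyMeasure_exp_of_LW, sb_of_algebraicIndependent, mem_adjoin_SFset_I' …).
All parts share the namespace `Summit.Schanuel.Schanuel.Theorems.RootDecomp1KHyper` (node sub-namespace `HyperCell` reproduced); statements and proofs
are the node's verbatim; `--supports stmt-Schanuel-33363` (A₄ʰ HyperLiouvilleSchanuel). Sorry-free; standard axioms. Nothing here proves Schanuel; rung 0.
-/

set_option linter.dupNamespace false
set_option linter.unusedSectionVars false

noncomputable section

open Complex IntermediateField Filter Polynomial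

namespace Summit.Schanuel.Schanuel.Theorems.RootDecomp1KHyper

variable {n K : ℕ}

/-- `trdeg_ℚ` is monotone along inclusions of subfields (Mathlib `trdeg_le_of_injective`). -/
private theorem trdeg_mono {F E : Type*} [Field F] [Field E] [Algebra F E] {L L' : IntermediateField F E}
    (h : L ≤ L') : Algebra.trdeg F L ≤ Algebra.trdeg F L' :=
  trdeg_le_of_injective (IntermediateField.inclusion h) (IntermediateField.inclusion_injective h)

/-- A field generated by a set `S` has transcendence degree `≤ #S` (copy of the tree's
`Literature.NumberTheory.Transcendental.trdeg_adjoin_le_mk`, module cone unbuilt tonight). -/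
private theorem trdeg_adjoin_le_mk {F E : Type*} [Field F] [Field E] [Algebra F E] (S : Set E) :
    Algebra.trdeg F ↥(adjoin F S) ≤ Cardinal.mk S := by
  haveI := Literature.NumberTheory.Transcendental.isAlgebraic_adjoin_over_algebraAdjoin (F := F) S
  exact (Algebra.IsAlgebraic.trdeg_le_cardinalMk F (((↑) : adjoin F S → E) ⁻¹' S)).trans
    (Cardinal.mk_preimage_of_injective _ _ Subtype.val_injective)

set_option synthInstance.maxHeartbeats 400000 in
/-- **Subadditivity** `trdeg_K K(S ∪ T) ≤ trdeg_K K(S) + trdeg_K K(T)` (copy of the tree's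
`Literature.NumberTheory.Transcendental.trdeg_adjoin_union_le`, module cone unbuilt tonight). -/
private theorem trdeg_adjoin_union_le {K E : Type*} [Field K] [Field E] [Algebra K E] (S T : Set E) :
    Algebra.trdeg K ↥(adjoin K (S ∪ T)) ≤
      Algebra.trdeg K ↥(adjoin K S) + Algebra.trdeg K ↥(adjoin K T) := by
  have htower := trdeg_add_eq K (adjoin K S) (A := adjoin (adjoin K S) T)
  have heq : Algebra.trdeg K (adjoin (adjoin K S) T) = Algebra.trdeg K (adjoin K (S ∪ T)) := by
    rw [← (equivOfEq (adjoin_adjoin_left K S T)).trdeg_eq]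
    rfl
  have hbc := Literature.NumberTheory.Transcendental.trdeg_adjoin_le_of_le (K := K) (E := E)
    (F₁ := adjoin K (∅ : Set E)) (F₂ := adjoin K S) (adjoin.mono K _ _ (Set.empty_subset S)) T
  have htower0 := trdeg_add_eq K (adjoin K (∅ : Set E)) (A := adjoin (adjoin K (∅ : Set E)) T)
  have heq0 : Algebra.trdeg K (adjoin (adjoin K (∅ : Set E)) T) = Algebra.trdeg K (adjoin K T) := by
    have h1 : Algebra.trdeg K ↥(adjoin K T) = Algebra.trdeg K ↥(adjoin K (∅ ∪ T)) := by
      rw [Set.empty_union]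
    rw [h1, ← (equivOfEq (adjoin_adjoin_left K ∅ T)).trdeg_eq]
    rfl
  have hzero : Algebra.trdeg K ↥(adjoin K (∅ : Set E)) = 0 :=
    nonpos_iff_eq_zero.mp ((trdeg_adjoin_le_mk (F := K) (∅ : Set E)).trans (by simp))
  rw [hzero, zero_add, heq0] at htower0
  rw [heq] at htower
  rw [← htower, ← htower0]
  gcongr

/-- `k` algebraically independent numbers generate a field of transcendence degree `≥ k`. -/
private theorem le_trdeg_adjoin_of_algebraicIndependent {ι : Type} [Fintype ι] {y : ι → ℂ}
    (h : AlgebraicIndependent ℚ y) :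
    (Fintype.card ι : Cardinal) ≤ Algebra.trdeg ℚ ↥(adjoin ℚ (Set.range y)) := by
  let f : ι → adjoin ℚ (Set.range y) := fun i => ⟨y i, subset_adjoin ℚ _ ⟨i, rfl⟩⟩
  have hf : AlgebraicIndependent ℚ f := AlgebraicIndependent.of_comp (adjoin ℚ (Set.range y)).val h
  simpa using hf.cardinalMk_le_trdeg

/-- §3. Tools: Liouville numbers are transcendental; a Liouville real outside any finite span: auxiliary statement `isAlgebraic_I` (lens 6 gen 9 node, ported verbatim). -/
private theorem isAlgebraic_I : IsAlgebraic ℚ Complex.I := by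
  refine ⟨X ^ 2 + 1, ?_, ?_⟩
  · exact (Polynomial.monic_X_pow_add_C (1 : ℚ) two_ne_zero).ne_zero
  · simp [Complex.I_sq]

/-- An algebraic relation of `b` over `ℚ(θ)`, `θ` algebraically independent, is witnessed by
INTEGER polynomials: `Σ_{k ≤ K} G_k(θ) b^k = 0`, `G_K ≠ 0`. -/
theorem exists_int_mvrelation {θ : Fin n → ℂ} {b : ℂ}
    (hb : IsAlgebraic (Algebra.adjoin ℚ (Set.range θ)) b) :
    ∃ (K : ℕ) (G : Fin (K + 1) → MvPolynomial (Fin n) ℤ), G (Fin.last K) ≠ 0 ∧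
      ∑ k : Fin (K + 1), MvPolynomial.aeval θ (G k) * b ^ (k : ℕ) = 0 := by
  obtain ⟨μ, hμ0, hμb⟩ := hb
  -- each coefficient of μ is a rational polynomial in θ
  have hcoef : ∀ k : ℕ, ∃ g : MvPolynomial (Fin n) ℚ,
      MvPolynomial.aeval θ g = ((μ.coeff k : Algebra.adjoin ℚ (Set.range θ)) : ℂ) := by
    intro k
    have hm : ((μ.coeff k : Algebra.adjoin ℚ (Set.range θ)) : ℂ) ∈
        (MvPolynomial.aeval θ : MvPolynomial (Fin n) ℚ →ₐ[ℚ] ℂ).range :=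
      (Algebra.adjoin_range_eq_range_aeval ℚ θ).le (μ.coeff k).2
    exact (AlgHom.mem_range _).1 hm
  choose g hg using hcoef
  -- clear denominators coefficientwise
  have hnorm : ∀ k : ℕ, ∃ (G : MvPolynomial (Fin n) ℤ) (c : ℤ), c ≠ 0 ∧
      MvPolynomial.map (Int.castRingHom ℚ) G = MvPolynomial.C (c : ℚ) * g k := by
    intro k
    obtain ⟨N, G, hN, hG⟩ := exists_int_mul_eq_map (g k)
    exact ⟨G, N, hN, hG⟩
  choose G₀ c hc0 hG₀ using hnorm
  have haeval : ∀ k : ℕ,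
      MvPolynomial.aeval θ (G₀ k) = (c k : ℂ) * MvPolynomial.aeval θ (g k) := by
    intro k
    rw [← mvaeval_int_map θ (G₀ k), hG₀ k, map_mul, MvPolynomial.aeval_C]
    simp
  set K := μ.natDegree with hK
  -- the relation Σ_k coeff_k(θ) b^k = 0, as a `Fin (K+1)`-sum
  have hrel : ∑ k : Fin (K + 1), MvPolynomial.aeval θ (g k) * b ^ (k : ℕ) = 0 := by
    have h1 : aeval b μ = ∑ i ∈ Finset.range (K + 1),
        ((μ.coeff i : Algebra.adjoin ℚ (Set.range θ)) : ℂ) * b ^ i := by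
      rw [Polynomial.aeval_def, Polynomial.eval₂_eq_sum_range]
      rfl
    rw [hμb] at h1
    rw [Finset.sum_range (fun i =>
      ((μ.coeff i : Algebra.adjoin ℚ (Set.range θ)) : ℂ) * b ^ i)] at h1
    rw [h1]
    refine Finset.sum_congr rfl fun k _ => ?_
    rw [hg]
  refine ⟨K, fun k => MvPolynomial.C (∏ j ∈ Finset.univ.erase k, c j) * G₀ k, ?_, ?_⟩
  · -- the top coefficient is nonzero
    have hlead : μ.coeff K ≠ 0 := by
      rw [hK]; exact Polynomial.leadingCoeff_ne_zero.mpr hμ0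
    have hGK : G₀ K ≠ 0 := by
      intro h0
      have h1 : (c K : ℂ) * MvPolynomial.aeval θ (g K) = 0 := by rw [← haeval, h0, map_zero]
      rcases mul_eq_zero.mp h1 with h | h
      · exact hc0 K (by exact_mod_cast h)
      · rw [hg] at h
        exact hlead (by exact_mod_cast h)
    show MvPolynomial.C (∏ j ∈ Finset.univ.erase (Fin.last K), c j) * G₀ (Fin.last K) ≠ 0
    rw [Fin.val_last]
    refine mul_ne_zero ((MvPolynomial.C_eq_zero.not).mpr ?_) hGK
    exact Finset.prod_ne_zero_iff.mpr fun j _ => hc0 j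
  · -- the relation, multiplied through by B = ∏ c_j
    set B : ℤ := ∏ j : Fin (K + 1), c j with hB
    calc ∑ k : Fin (K + 1), MvPolynomial.aeval θ
          (MvPolynomial.C (∏ j ∈ Finset.univ.erase k, c j) * G₀ k) * b ^ (k : ℕ)
        = ∑ k : Fin (K + 1), (B : ℂ) * (MvPolynomial.aeval θ (g k) * b ^ (k : ℕ)) := by
          refine Finset.sum_congr rfl fun k _ => ?_
          have e2 : (((∏ j ∈ Finset.univ.erase k, c j : ℤ) : ℂ)) * (c k : ℂ) = (B : ℂ) := by
            rw [← Int.cast_mul, Finset.prod_erase_mul _ _ (Finset.mem_univ k)]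
          rw [map_mul, MvPolynomial.aeval_C, haeval, ← e2]
          simp only [algebraMap_int_eq, eq_intCast]
          ring
      _ = (B : ℂ) * ∑ k : Fin (K + 1), MvPolynomial.aeval θ (g k) * b ^ (k : ℕ) := by
          rw [Finset.mul_sum]
      _ = 0 := by rw [hrel, mul_zero]

/-- Verbatim copy of the Literature named fact
`Literature.NumberTheory.Transcendental.Ably1994_lindemannWeierstrass_measure` (M. Ably, Acta
Arith. 67 (1994) 29–45, Théorème p. 30: a measure of algebraic independence for
`e^{y₁}, …, e^{yₙ}`, `yᵢ` algebraic and ℚ-linearly independent), PROVED in the tree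
(`Ably1994_lindemannWeierstrass_measure_holds`, `LindemannWeierstrassMeasureHolds.lean`); taken as
the hypothesis `hLW` (discharged by name). -/
def LWMeasure : Prop :=
  ∀ (n : ℕ) (y : Fin n → ℂ), (∀ i, IsAlgebraic ℚ (y i)) → LinearIndependent ℚ y →
    ∃ C c₂ : ℝ, 0 < C ∧ 0 < c₂ ∧
      ∀ (P : MvPolynomial (Fin n) ℤ) (D H : ℕ), P ≠ 0 → P.totalDegree ≤ D →
        (∀ m, |P.coeff m| ≤ (H : ℤ)) →
          Real.exp (-(c₂ * (D : ℝ) ^ n *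
              (Real.log H + Real.exp (C * (D : ℝ) ^ n * Real.log ((D : ℝ) + 1))))) ≤
            ‖MvPolynomial.aeval (fun i => Complex.exp (y i)) P‖

/-- A measure of the shape `exp(−(A·log H + B)) ≤ |P(θ)|` in total degree `≤ d` for all `H ≥ 1`
bounding the coefficients (`A ≥ 0`; `A, B` depending on `d` only) is an `MvPolyMeasure`
(`τ = ⌈A⌉`, `C = e^B`, read at `H = mvlen P`). -/
theorem mvPolyMeasure_of_heightMeasure {θ : Fin n → ℂ}
    (h : ∀ d : ℕ, ∃ A B : ℝ, 0 ≤ A ∧ ∀ (P : MvPolynomial (Fin n) ℤ) (H : ℕ), P ≠ 0 →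
      P.totalDegree ≤ d → 1 ≤ H → (∀ m, |P.coeff m| ≤ (H : ℤ)) →
      Real.exp (-(A * Real.log H + B)) ≤ ‖MvPolynomial.aeval θ P‖) :
    MvPolyMeasure θ := by
  intro d
  obtain ⟨A, B, hA, hmeas⟩ := h d
  set τ : ℕ := ⌈A⌉₊ with hτ
  have hAτ : A ≤ τ := Nat.le_ceil A
  refine ⟨Real.exp B, τ, Real.exp_pos B, fun P hP hdeg => ?_⟩
  set H : ℕ := (mvlen P).toNat with hH
  have hlen1 : 1 ≤ mvlen P := one_le_mvlen hP
  have hHZ : (H : ℤ) = mvlen P := by rw [hH, Int.toNat_of_nonneg (mvlen_nonneg P)]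
  have hH1 : 1 ≤ H := by
    have : (1 : ℤ) ≤ (H : ℤ) := by rw [hHZ]; exact hlen1
    exact_mod_cast this
  have hcoeff : ∀ m, |P.coeff m| ≤ (H : ℤ) := fun m => by
    rw [hHZ]; exact abs_coeff_le_mvlen P m
  have hw := hmeas P H hP hdeg hH1 hcoeff
  have hHpos : (0 : ℝ) < H := by exact_mod_cast (show 0 < H by omega)
  have hlogH0 : 0 ≤ Real.log H := Real.log_nonneg (by exact_mod_cast hH1)
  have h1 : (1 : ℝ) ≤ Real.exp (A * Real.log H + B) * ‖MvPolynomial.aeval θ P‖ := by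
    have h3 := mul_le_mul_of_nonneg_left hw (Real.exp_pos (A * Real.log H + B)).le
    rwa [← Real.exp_add, add_neg_cancel, Real.exp_zero] at h3
  have hHR : (H : ℝ) = ((mvlen P : ℤ) : ℝ) := by exact_mod_cast hHZ
  have hexpH : Real.exp (A * Real.log H) ≤ ((mvlen P : ℤ) : ℝ) ^ τ := by
    calc Real.exp (A * Real.log H) ≤ Real.exp ((τ : ℝ) * Real.log H) :=
          Real.exp_le_exp.mpr (mul_le_mul_of_nonneg_right hAτ hlogH0)
      _ = (H : ℝ) ^ τ := by rw [Real.exp_nat_mul, Real.exp_log hHpos]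
      _ = ((mvlen P : ℤ) : ℝ) ^ τ := by rw [hHR]
  calc (1 : ℝ) ≤ Real.exp (A * Real.log H + B) * ‖MvPolynomial.aeval θ P‖ := h1
    _ = Real.exp B * Real.exp (A * Real.log H) * ‖MvPolynomial.aeval θ P‖ := by
        rw [Real.exp_add]; ring
    _ ≤ Real.exp B * ((mvlen P : ℤ) : ℝ) ^ τ * ‖MvPolynomial.aeval θ P‖ := by gcongr

/-- `(e^{y₁}, …, e^{yₙ})`, `yᵢ ∈ ℚ̄` ℚ-linearly independent, has an `MvPolyMeasure` (mod `hLW`). -/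
theorem mvPolyMeasure_exp_of_LW (hLW : LWMeasure) {y : Fin n → ℂ} (hy : ∀ i, IsAlgebraic ℚ (y i))
    (hli : LinearIndependent ℚ y) : MvPolyMeasure (fun i => cexp (y i)) := by
  obtain ⟨C, c₂, hC, hc₂, hall⟩ := hLW n y hy hli
  refine mvPolyMeasure_of_heightMeasure fun d => ?_
  refine ⟨c₂ * (d : ℝ) ^ n,
    c₂ * (d : ℝ) ^ n * Real.exp (C * (d : ℝ) ^ n * Real.log ((d : ℝ) + 1)),
    by positivity, fun P H hP hdeg _hH hcoeff => ?_⟩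
  have hw := hall P d H hP hdeg hcoeff
  have e : c₂ * (d : ℝ) ^ n * Real.log H +
      c₂ * (d : ℝ) ^ n * Real.exp (C * (d : ℝ) ^ n * Real.log ((d : ℝ) + 1)) =
      c₂ * (d : ℝ) ^ n *
        (Real.log H + Real.exp (C * (d : ℝ) ^ n * Real.log ((d : ℝ) + 1))) := by ring
  rw [e]; exact hw

/-- `k` algebraically independent elements of `ℚ(z, e^z, i)` give `SB N z` for `N ≤ k`. -/
theorem sb_of_algebraicIndependent {ι : Type} [Fintype ι] {u : ι → ℂ}
    (hai : AlgebraicIndependent ℚ u) {N : ℕ} {z : Fin N → ℂ} (hN : N ≤ Fintype.card ι)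
    (hu : ∀ i, u i ∈ adjoin ℚ (SFset z ∪ {I})) : SB N z := by
  have h2 := le_trdeg_adjoin_of_algebraicIndependent hai
  have hsub : Set.range u ⊆ (adjoin ℚ (SFset z ∪ {I}) : Set ℂ) := by
    rintro x ⟨i, rfl⟩; exact hu i
  have hle : adjoin ℚ (Set.range u) ≤ adjoin ℚ (SFset z ∪ {I}) := adjoin_le_iff.mpr hsub
  have h3 := h2.trans (trdeg_mono hle)
  have h4 := trdeg_adjoin_union_le (K := ℚ) (SFset z) ({I} : Set ℂ)
  rw [trdeg_adjoin_singleton_eq_zero isAlgebraic_I.isIntegral, add_zero] at h4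
  have h5 : ((N : ℕ) : Cardinal) ≤ (Fintype.card ι : Cardinal) := by exact_mod_cast hN
  exact h5.trans (h3.trans h4)

/-- §10f. The Lindemann–Weierstrass supplier and the LW storey of S_L′ at every level: auxiliary statement `mem_adjoin_SFset_I'` (lens 6 gen 9 node, ported verbatim). -/
theorem mem_adjoin_SFset_I' {N : ℕ} {z : Fin N → ℂ} {x : ℂ} (hx : x ∈ SFset z) :
    x ∈ adjoin ℚ (SFset z ∪ {I}) :=
  subset_adjoin ℚ _ (Or.inl hx)

/-- **Round-3 cut predicate** — the tuple admits integer linear forms of every polynomial order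
of smallness («`[z]` is a Liouville point of ℙⁿ⁻¹»). -/
def LinLiouville {n : ℕ} (z : Fin n → ℂ) : Prop :=
  ∀ ω : ℕ, ∃ h : Fin n → ℤ, h ≠ 0 ∧ ‖∑ i, (h i : ℂ) * z i‖ < 1 / (1 + ∑ i, (|h i| : ℝ)) ^ ω

/-- §11a. The predicate, monotonicity in ω, position relative to (T.H.): auxiliary statement `hsum_nonneg` (lens 6 gen 9 node, ported verbatim). -/
theorem hsum_nonneg {n : ℕ} (h : Fin n → ℤ) : 0 ≤ ∑ i, (|h i| : ℝ) :=
  Finset.sum_nonneg fun i _ => by positivity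

/-- §11a. The predicate, monotonicity in ω, position relative to (T.H.): auxiliary statement `one_le_hsum` (lens 6 gen 9 node, ported verbatim). -/
theorem one_le_hsum {n : ℕ} {h : Fin n → ℤ} (hh : h ≠ 0) : 1 ≤ ∑ i, (|h i| : ℝ) := by
  obtain ⟨i, hi⟩ : ∃ i, h i ≠ 0 := Function.ne_iff.mp hh
  have h1 : (1 : ℝ) ≤ (|h i| : ℝ) := by exact_mod_cast Int.one_le_abs hi
  exact h1.trans (Finset.single_le_sum (f := fun j => (|h j| : ℝ)) (fun j _ => by positivity)
    (Finset.mem_univ i))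

/-- §11a. The predicate, monotonicity in ω, position relative to (T.H.): auxiliary statement `abs_le_hsum` (lens 6 gen 9 node, ported verbatim). -/
theorem abs_le_hsum {n : ℕ} (h : Fin n → ℤ) (i : Fin n) : (|h i| : ℝ) ≤ ∑ j, (|h j| : ℝ) :=
  Finset.single_le_sum (f := fun j => (|h j| : ℝ)) (fun j _ => by positivity) (Finset.mem_univ i)

/-- §11a. The predicate, monotonicity in ω, position relative to (T.H.): auxiliary statement `linLiouville_bound_le_half_pow` (lens 6 gen 9 node, ported verbatim). -/
theorem linLiouville_bound_le_half_pow {n : ℕ} {h : Fin n → ℤ} (hh : h ≠ 0) (ω : ℕ) :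
    1 / (1 + ∑ i, (|h i| : ℝ)) ^ ω ≤ 1 / 2 ^ ω :=
  one_div_le_one_div_of_le (by positivity)
    (pow_le_pow_left₀ (by norm_num) (by linarith [one_le_hsum hh]) ω)

/-- `2^{-c} ≤ x` for some `c`, for every `x > 0`. -/
theorem exists_half_pow_le {x : ℝ} (hx : 0 < x) : ∃ c : ℕ, 1 / (2 : ℝ) ^ c ≤ x := by
  obtain ⟨c, hc⟩ := exists_pow_lt_of_lt_one hx (by norm_num : (1 / 2 : ℝ) < 1)
  rw [one_div_pow] at hc
  exact ⟨c, hc.le⟩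

/-- `x ≤ 2^c` for some `c`. -/
theorem exists_le_two_pow (x : ℝ) : ∃ c : ℕ, x ≤ (2 : ℝ) ^ c := by
  obtain ⟨c, hc⟩ := exists_nat_ge x
  refine ⟨c, hc.trans ?_⟩
  exact_mod_cast (Nat.lt_two_pow_self (n := c)).le

/-- On a ℚ-free tuple no non-zero integer form vanishes. -/
theorem form_ne_zero_of_linearIndependent {n : ℕ} {z : Fin n → ℂ} (hz : LinearIndependent ℚ z)
    {h : Fin n → ℤ} (hh : h ≠ 0) : ∑ i, (h i : ℂ) * z i ≠ 0 := by
  intro h0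
  apply hh
  have hrel : ∑ i, ((h i : ℚ) • z i) = 0 := by
    have e : ∀ i, ((h i : ℚ) • z i) = (h i : ℂ) * z i := fun i => by
      simp [Rat.smul_def]
    simp_rw [e]; exact h0
  have := Fintype.linearIndependent_iff.mp hz (fun i => (h i : ℚ)) hrel
  funext i
  simp only [Pi.zero_apply]
  exact_mod_cast this i

/-- §11b. Pairs: LinLiouville = «the ratio is a real Liouville number»: auxiliary statement `form_two` (lens 6 gen 9 node, ported verbatim). -/
theorem form_two (h : Fin 2 → ℤ) (z : Fin 2 → ℂ) :
    ∑ i, (h i : ℂ) * z i = h 0 * z 0 + h 1 * z 1 := by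
  rw [Fin.sum_univ_two]

/-- §11b. Pairs: LinLiouville = «the ratio is a real Liouville number»: auxiliary statement `hsum_two` (lens 6 gen 9 node, ported verbatim). -/
theorem hsum_two (h : Fin 2 → ℤ) : ∑ i, (|h i| : ℝ) = |(h 0 : ℝ)| + |(h 1 : ℝ)| := by
  simp [Fin.sum_univ_two]

/-- For a ℚ-free `LinLiouville` pair the ratio `z₁/z₀` is REAL: otherwise every non-zero form
`h₀z₀ + h₁z₁ = z₀ (h₀ + h₁ z₁/z₀)` has norm `≥ ‖z₀‖ · min(1, |Im(z₁/z₀)|)`. -/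
theorem ratio_im_eq_zero_of_linLiouville {z : Fin 2 → ℂ} (hz : LinearIndependent ℚ z)
    (hL : LinLiouville z) : (z 1 / z 0).im = 0 := by
  by_contra him
  have h0 : z 0 ≠ 0 := hz.ne_zero 0
  have hn0 : 0 < ‖z 0‖ := norm_pos_iff.mpr h0
  set δ : ℝ := |(z 1 / z 0).im| with hδ
  have hδ0 : 0 < δ := abs_pos.mpr him
  set m : ℝ := min 1 δ with hm
  have hm0 : 0 < m := lt_min one_pos hδ0
  -- every non-zero form is bounded below by ‖z 0‖ * m
  have hlow : ∀ h : Fin 2 → ℤ, h ≠ 0 → ‖z 0‖ * m ≤ ‖∑ i, (h i : ℂ) * z i‖ := by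
    intro h hh
    have e : ∑ i, (h i : ℂ) * z i = z 0 * ((h 0 : ℂ) + (h 1 : ℂ) * (z 1 / z 0)) := by
      rw [form_two]; field_simp
    rw [e, norm_mul]
    gcongr
    by_cases h1 : h 1 = 0
    · have h00 : h 0 ≠ 0 := by
        intro h00; apply hh; funext i; fin_cases i <;> simp [h00, h1]
      simp only [h1, Int.cast_zero, zero_mul, add_zero]
      calc m ≤ 1 := min_le_left _ _
        _ ≤ ‖(h 0 : ℂ)‖ := by
            rw [Complex.norm_intCast]; exact_mod_cast Int.one_le_abs h00
    · calc m ≤ δ := min_le_right _ _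
        _ ≤ |(h 1 : ℝ)| * δ := by
            have : (1 : ℝ) ≤ |(h 1 : ℝ)| := by exact_mod_cast Int.one_le_abs h1
            nlinarith
        _ = |((h 0 : ℂ) + (h 1 : ℂ) * (z 1 / z 0)).im| := by
            rw [hδ, ← abs_mul]; congr 1; simp
        _ ≤ ‖(h 0 : ℂ) + (h 1 : ℂ) * (z 1 / z 0)‖ := Complex.abs_im_le_norm _
  obtain ⟨c, hc⟩ := exists_half_pow_le (mul_pos hn0 hm0)
  obtain ⟨h, hh, hlt⟩ := hL (c + 1)
  have h2 := linLiouville_bound_le_half_pow hh (c + 1)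
  have h3 : 1 / (2 : ℝ) ^ (c + 1) < 1 / 2 ^ c :=
    one_div_lt_one_div_of_lt (by positivity) (pow_lt_pow_right₀ (by norm_num) (by omega))
  linarith [hlow h hh]

end Summit.Schanuel.Schanuel.Theorems.RootDecomp1KHyper
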